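import Literature.Analysis.FluidPDE.JiaSverak2014LocalRegularity
import Literature.Analysis.FluidPDE.JiaSverak2014DatumCutoff
import Literature.Analysis.FluidPDE.JiaSverak2014RegularFlow
import Literature.Analysis.FluidPDE.JiaSverak2014SlabAprioriEstimate
import Literature.Analysis.FluidPDE.JiaSverak2014DecayIteration
import Literature.Analysis.FluidPDE.JiaSverak2014BoundednessNearInitialTime
import Literature.Analysis.FluidPDE.JiaSverak2014HolderRepresentative
import Literature.Analysis.FluidPDE.JiaSverak2014EndpointExtension
import HarnessLib

/-!
# Jia–Šverák 2014, Theorem 3.2 (local Hölder regularity near `t = 0`): the proof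

Analysis/FluidPDE proofs file (theorems only, no new definitions, no new named facts): the
discharge `jia_sverak_2014_theorem_3_2_holds` of the named fact
`Literature.Analysis.FluidPDE.jia_sverak_2014_theorem_3_2` (`JiaSverak2014LocalRegularity.lean`;
H. Jia, V. Šverák, Invent. Math. 196 (2014) 233–265 = arXiv:1204.0529, §3 Thm. 3.1/3.2, proof
pp. 7–9), assembled from the parts (all in this directory, prefix `JiaSverak2014`):

* A (`DatumCutoff`): divergence-free localisation `a₀` of the datum, `a₀ = u₀` on `B_{4/3}(x₀)`,
  `|a₀| ≤ C_A M`, `supp a₀ ⊆ B₂(x₀)` (print: Step 1, the Bogovskii cut-off);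
* B (`RegularFlow`): the regular local Leray flow `a` of `a₀` on `(0, c₁/A²)`, `|a| ≤ 2A`,
  `√t |∇a| ≤ C₁ A` (print: "`a` … is regular by the local well-posedness theory");
* D (`SlabAprioriEstimate`): the a priori estimate of Lemma 3.1 for `u` and for `a`;
* E (`DecayIteration`): the decay `∫_{B(y,3/1024)} |u - a|²(t) + ∫∫ |∇(u - a)|² ≲ t^{3/2}`
  (print: (3.8), via the perturbed local energy inequality, Steps 2–3);
* F (`BoundednessNearInitialTime`): `|u| ≤ K_b` a.e. on `(0, min(T₂,T₀)) × B_{7/12}(x₀)`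
  (print: ε-regularity at the parabolic scale, p. 9);
* G (`HolderRepresentative`, `EndpointExtension`): the `(C, γ)`-parabolic-Hölderian
  representative on `[0, min(T,T')] × B̄_{1/4}(x₀)` attaining `u₀` (print: the representation
  `u = u₁ + u₂ + u₃`, p. 9).

All constants are fixed from `α, M, γ` before the solution is given, as the fact demands.

## References

* H. Jia, V. Šverák, Invent. Math. 196 (2014) = arXiv:1204.0529, §3, Thm. 3.1, Thm. 3.2 and
  their proofs (pp. 7–9). Bib key `JiaSverak2014`.
* P. G. Lemarié-Rieusset, *The Navier–Stokes Problem in the 21st Century* (2016), Prop. 13.4,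
  Thm. 13.7, Thm. 14.2. Bib key `LemarieRieusset2016`.
-/

noncomputable section

open MeasureTheory TopologicalSpace Set Function Filter Metric
open _root_.Topology
open scoped ENNReal NNReal

namespace Literature.Analysis.FluidPDE

open JiaSverak2014 Literature.Analysis.UnboundedOperators

/-- `|x - y|² ≤ 2|x|² + 2|y|²`. [folklore] -/
private theorem norm_sub_sq_le_two (x y : EuclideanSpace ℝ (Fin 3)) :
    ‖x - y‖ ^ 2 ≤ 2 * ‖x‖ ^ 2 + 2 * ‖y‖ ^ 2 := by
  have h1 : ‖x - y‖ * ‖x - y‖ ≤ (‖x‖ + ‖y‖) * (‖x‖ + ‖y‖) :=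
    mul_self_le_mul_self (norm_nonneg _) (norm_sub_le x y)
  nlinarith [h1, sq_nonneg (‖x‖ - ‖y‖)]

/-- `|x - y|² ≤ 2|x|² + 2|y|²` for extended norms. [folklore] -/
private theorem enorm_sub_sq_le_two (x y : EuclideanSpace ℝ (Fin 3)) :
    ‖x - y‖ₑ ^ 2 ≤ 2 * ‖x‖ₑ ^ 2 + 2 * ‖y‖ₑ ^ 2 := by
  have e : ∀ v : EuclideanSpace ℝ (Fin 3), ‖v‖ₑ ^ 2 = ENNReal.ofReal (‖v‖ ^ 2) := fun v => by
    rw [← ofReal_norm, ← ENNReal.ofReal_pow (norm_nonneg _)]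
  calc ‖x - y‖ₑ ^ 2 = ENNReal.ofReal (‖x - y‖ ^ 2) := e _
    _ ≤ ENNReal.ofReal (2 * ‖x‖ ^ 2 + 2 * ‖y‖ ^ 2) := ENNReal.ofReal_le_ofReal (norm_sub_sq_le_two x y)
    _ = 2 * ‖x‖ₑ ^ 2 + 2 * ‖y‖ₑ ^ 2 := by
        rw [ENNReal.ofReal_add (by positivity) (by positivity), ENNReal.ofReal_mul (by norm_num),
          ENNReal.ofReal_mul (by norm_num), ENNReal.ofReal_ofNat, e x, e y]

/-- `ofReal (|X - Y|²_F) ≤ 2 ofReal |X|²_F + 2 ofReal |Y|²_F` (from the tree lemma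
`frobeniusNormSq_sub_le`, `NSWeakStrongUniqueness.lean`). [folklore] -/
private theorem ofReal_frobeniusNormSq_sub_le_two (X Y : (EuclideanSpace ℝ (Fin 3)) →L[ℝ] (EuclideanSpace ℝ (Fin 3))) :
    ENNReal.ofReal (frobeniusNormSq (X - Y)) ≤
      2 * ENNReal.ofReal (frobeniusNormSq X) + 2 * ENNReal.ofReal (frobeniusNormSq Y) := by
  have hX := frobeniusNormSq_nonneg X
  have hY := frobeniusNormSq_nonneg Y
  calc ENNReal.ofReal (frobeniusNormSq (X - Y)) ≤ ENNReal.ofReal (2 * frobeniusNormSq X + 2 * frobeniusNormSq Y) :=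
        ENNReal.ofReal_le_ofReal (frobeniusNormSq_sub_le X Y)
    _ = 2 * ENNReal.ofReal (frobeniusNormSq X) + 2 * ENNReal.ofReal (frobeniusNormSq Y) := by
        rw [ENNReal.ofReal_add (by positivity) (by positivity), ENNReal.ofReal_mul (by norm_num),
          ENNReal.ofReal_mul (by norm_num), ENNReal.ofReal_ofNat]

set_option maxHeartbeats 6400000 in
/-- **Jia–Šverák 2014, Theorem 3.2** (local Hölder regularity of local Leray solutions near the
initial time, for locally Hölder continuous data): the named fact
`jia_sverak_2014_theorem_3_2` holds. Proof: module docstring (Parts A–G).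
[cite: JiaSverak2014, §3 Thm. 3.2 (= Thm. 3.1 + Remark 3.2), proof pp. 7–9] -/
theorem jia_sverak_2014_theorem_3_2_holds : jia_sverak_2014_theorem_3_2 := by
  intro α M γ hγ0 hγ1
  have hγ0' : 0 < (γ : ℝ) := by exact_mod_cast hγ0
  have hγ1' : (γ : ℝ) < 1 := by exact_mod_cast hγ1
  have hM0 : 0 ≤ (M : ℝ) := M.coe_nonneg
  /- ## universal constants -/
  -- Part A
  obtain ⟨CA, hCA0, hloc⟩ := exists_divFree_localization
  set A : ℝ := CA * M + 1 with hAdef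
  have hA : 0 < A := by rw [hAdef]; positivity
  have hCAM : CA * M ≤ A := by rw [hAdef]; linarith
  -- Part B
  obtain ⟨c₁, hc₁, C₁, hC₁, hflow⟩ := exists_regular_flow
  set S₀ : ℝ := c₁ / A ^ 2 with hS₀
  set S₂ : ℝ := 4 * c₁ / A ^ 2 with hS₂
  have hS₀pos : 0 < S₀ := by rw [hS₀]; positivity
  have hS₀S₂ : S₀ ≤ S₂ := by
    rw [hS₀, hS₂, div_le_div_iff_of_pos_right (by positivity)]; linarith
  -- Part D
  obtain ⟨ε₀, hε₀, hε₀1, CD, hD⟩ := apriori_unit_scale_slab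
  set v1 : ℝ≥0 := (volume (ball (0 : EuclideanSpace ℝ (Fin 3)) 1)).toNNReal with hv1
  have hv1c : (v1 : ℝ≥0∞) = volume (ball (0 : EuclideanSpace ℝ (Fin 3)) 1) := ENNReal.coe_toNNReal measure_ball_lt_top.ne
  -- the size of the localised datum `a₀` in `L²_uloc`
  set αa : ℝ≥0 := Real.toNNReal ((CA * M) ^ 2) * v1 with hαa
  -- the horizons of the a priori estimate
  set TD : ℝ≥0 → ℝ := fun β => (ε₀ : ℝ) / (1 + (β : ℝ) ^ 2) with hTD
  have hTDpos : ∀ β, 0 < TD β := fun β => by simp only [hTD]; positivity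
  have hTDε : ∀ β, TD β ≤ ε₀ := fun β => by
    simp only [hTD]; rw [div_le_iff₀ (by positivity)]; nlinarith [hε₀.le, sq_nonneg (β : ℝ)]
  have hTDα : ∀ β : ℝ≥0, TD β * (β : ℝ) ^ 2 ≤ ε₀ := fun β => by
    simp only [hTD]; rw [div_mul_eq_mul_div, div_le_iff₀ (by positivity)]; nlinarith [hε₀.le, sq_nonneg (β : ℝ)]
  set Tstar : ℝ := min (min S₀ 1) (min (TD α) (TD αa)) with hTstar
  have hTstar : 0 < Tstar := lt_min (lt_min hS₀pos one_pos) (lt_min (hTDpos _) (hTDpos _))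
  have hTS₀ : Tstar ≤ S₀ := (min_le_left _ _).trans (min_le_left _ _)
  have hT1 : Tstar ≤ 1 := (min_le_left _ _).trans (min_le_right _ _)
  have hTα : Tstar ≤ TD α := (min_le_right _ _).trans (min_le_left _ _)
  have hTαa : Tstar ≤ TD αa := (min_le_right _ _).trans (min_le_right _ _)
  -- energies
  set αu : ℝ≥0 := 2 * (CD * α) with hαu
  set αA : ℝ≥0 := Real.toNNReal ((2 * A) ^ 2) * v1 with hαA
  set αv : ℝ≥0 := 2 * αu + 2 * αA with hαv
  set E₀ : ℝ≥0 := αv + (2 * (CD * α) + 2 * (CD * αa)) with hE₀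
  -- Parts E, F, G
  obtain ⟨Λ, hΛ⟩ := decay_iteration A C₁ αv E₀
  obtain ⟨T₂, hT₂, Kb, hF⟩ := ae_bound_near_initial_time A Λ αu hA (7 / 12 : ℝ)
  obtain ⟨CU, hG6⟩ := holder_representative M γ hγ0' hγ1' (Kb := max Kb 0) (le_max_right _ _) αu
  set T : ℝ := min T₂ Tstar with hTdef
  have hT : 0 < T := lt_min hT₂ hTstar
  refine ⟨T, hT, CU, ?_⟩
  intro u₀ x₀ T' u p hm₀ hdiv hα hdec hM hH hT' hu
  /- ## Part A: the localised datum -/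
  have hfin : ∀ z : EuclideanSpace ℝ (Fin 3), ∫⁻ x in ball z 1, ‖u₀ x‖ₑ ^ 2 < ∞ := fun z =>
    (hα z).trans_lt ENNReal.coe_lt_top
  obtain ⟨a₀, ha₀m, ha₀div, ha₀eq, ha₀supp, ha₀bd⟩ := hloc u₀ x₀ M hm₀ hdiv hfin hM
  have ha₀A : ∀ x, ‖a₀ x‖ ≤ A := fun x => (ha₀bd x).trans hCAM
  obtain ⟨ha₀3, ha₀inf⟩ := memLp_of_bound_of_eq_zero_off_ball ha₀m ha₀A ha₀supp 3
  /- ## Part B: the regular flow -/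
  obtain ⟨a, π, pK, haL, hcl, habd, hagrad⟩ := hflow hA ha₀m ha₀3 ha₀div ha₀inf
  /- ## the restricted solution and the weak gradients -/
  set Tu : ℝ := min Tstar T' with hTu
  have hTupos : 0 < Tu := lt_min hTstar hT'
  have hTuT' : Tu ≤ T' := min_le_right _ _
  have hTuS : Tu ≤ Tstar := min_le_left _ _
  have hTuS₀ : Tu ≤ S₀ := hTuS.trans hTS₀
  have hTuS₂ : Tu ≤ S₂ := hTuS₀.trans hS₀S₂
  have hTu1 : Tu ≤ 1 := hTuS.trans hT1
  have huT : IsLocalLeraySolutionOn Tu 1 u₀ u p := hu.mono hTuT'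
  obtain ⟨G, hG', hGb'⟩ := hu.uniformLocalGradient
  have hG : HasWeakSpatialGradientOn (slab (EuclideanSpace ℝ (Fin 3)) (Ioo 0 Tu) isOpen_Ioo) u G :=
    hG'.mono (slab_mono (Ioo_subset_Ioo_right hTuT'))
  have hGb : ∀ R : ℝ, 0 < R → ∃ C : ℝ≥0, ∀ y' : EuclideanSpace ℝ (Fin 3),
      ∫⁻ z in Ioo 0 Tu ×ˢ ball y' R, ENNReal.ofReal (frobeniusNormSq (G z.1 z.2)) ≤ C := by
    intro R hR
    obtain ⟨C, hC⟩ := hGb' R hR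
    exact ⟨C, fun y' => (lintegral_mono_set (Set.prod_mono (Ioo_subset_Ioo_right hTuT') Subset.rfl)).trans (hC y')⟩
  -- the classical gradient of the flow is its weak gradient on `(0, S₀) × ℝ³`
  have hslabS : ((slab (EuclideanSpace ℝ (Fin 3)) (Ioo 0 S₀) isOpen_Ioo : Opens (ℝ × EuclideanSpace ℝ (Fin 3))) :
      Set (ℝ × EuclideanSpace ℝ (Fin 3))) ⊆ Ioo 0 S₂ ×ˢ (univ : Set (EuclideanSpace ℝ (Fin 3))) := fun z hz =>
    ⟨Ioo_subset_Ioo_right hS₀S₂ (mem_slab.1 hz), mem_univ _⟩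
  have ha1 : ContDiffOn ℝ 1 (uncurry a) (Ioo 0 S₂ ×ˢ (univ : Set (EuclideanSpace ℝ (Fin 3)))) :=
    hcl.smooth_velocity.of_le (show ((1 : ℕ) : WithTop ℕ∞) ≤ _ by norm_cast)
  have hDa : HasWeakSpatialGradientOn (slab (EuclideanSpace ℝ (Fin 3)) (Ioo 0 S₀) isOpen_Ioo) a fun t x => fderiv ℝ (a t) x :=
    hasWeakSpatialGradientOn_of_contDiffOn isOpen_Ioo hslabS ha1
  /- ## Part D: the a priori estimates for `u` and for `a` -/
  have two_mul_ge : ∀ c : ℝ≥0∞, c ≤ 2 * c := fun c => by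
    calc c = 1 * c := (one_mul _).symm
      _ ≤ 2 * c := by gcongr; norm_num
  have hα2 : ∀ y : EuclideanSpace ℝ (Fin 3), ∫⁻ x in ball y 1, ‖u₀ x‖ₑ ^ 2 ≤ 2 * (α : ℝ≥0∞) := fun y =>
    (hα y).trans (two_mul_ge _)
  have hTuα : Tu * (α : ℝ) ^ 2 ≤ (ε₀ : ℝ) :=
    (mul_le_mul_of_nonneg_right (hTuS.trans hTα) (sq_nonneg _)).trans (hTDα α)
  obtain ⟨hEu, hGu, -⟩ := hD u₀ u p G α T' Tu hm₀ hu hG' hα2 hTupos hTuT' ((hTuS.trans hTα).trans (hTDε α)) hTuα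
  -- the datum `a₀` in `L²_uloc`
  have hαa2 : ∀ y : EuclideanSpace ℝ (Fin 3), ∫⁻ x in ball y 1, ‖a₀ x‖ₑ ^ 2 ≤ 2 * (αa : ℝ≥0∞) := by
    intro y
    have h1 : ∫⁻ x in ball y 1, ‖a₀ x‖ₑ ^ 2 ≤ ∫⁻ _ in ball y 1, ENNReal.ofReal ((CA * M) ^ 2) := by
      refine lintegral_mono fun x => ?_
      rw [← ofReal_norm, ← ENNReal.ofReal_pow (norm_nonneg _)]
      exact ENNReal.ofReal_le_ofReal (pow_le_pow_left₀ (norm_nonneg _) (ha₀bd x) 2)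
    rw [setLIntegral_const, Measure.addHaar_ball_center] at h1
    calc ∫⁻ x in ball y 1, ‖a₀ x‖ₑ ^ 2 ≤ ENNReal.ofReal ((CA * M) ^ 2) * volume (ball (0 : EuclideanSpace ℝ (Fin 3)) 1) := h1
      _ = (αa : ℝ≥0∞) := by rw [hαa, ENNReal.coe_mul, hv1c]; rfl
      _ ≤ 2 * αa := two_mul_ge _
  have hTuαa : Tu * (αa : ℝ) ^ 2 ≤ (ε₀ : ℝ) :=
    (mul_le_mul_of_nonneg_right (hTuS.trans hTαa) (sq_nonneg _)).trans (hTDα αa)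
  obtain ⟨-, hGa, -⟩ := hD a₀ a pK (fun t x => fderiv ℝ (a t) x) αa S₀ Tu ha₀m haL hDa hαa2 hTupos hTuS₀
    ((hTuS.trans hTαa).trans (hTDε αa)) hTuαa
  /- ## the energies of `v = u - a` -/
  have hαu_c : (αu : ℝ≥0∞) = 2 * ((CD * α : ℝ≥0) : ℝ≥0∞) := by rw [hαu]; push_cast; ring
  have hEu' : ∀ᵐ t ∂(volume.restrict (Ioo 0 Tu)), ∀ z : EuclideanSpace ℝ (Fin 3),
      ∫⁻ x in ball z 1, ‖u t x‖ₑ ^ 2 ≤ αu := by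
    filter_upwards [hEu] with t ht z
    rw [hαu_c]; exact ht z
  -- `∫_{B₁(z)} |a(τ)|² ≤ α_A` for `τ ∈ (0, S₂)`
  have haE : ∀ τ ∈ Ioo 0 S₂, ∀ z : EuclideanSpace ℝ (Fin 3), ∫⁻ x in ball z 1, ‖a τ x‖ₑ ^ 2 ≤ αA := by
    intro τ hτ z
    have h1 : ∫⁻ x in ball z 1, ‖a τ x‖ₑ ^ 2 ≤ ∫⁻ _ in ball z 1, ENNReal.ofReal ((2 * A) ^ 2) := by
      refine lintegral_mono fun x => ?_
      rw [← ofReal_norm, ← ENNReal.ofReal_pow (norm_nonneg _)]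
      exact ENNReal.ofReal_le_ofReal (pow_le_pow_left₀ (norm_nonneg _) (habd τ hτ x) 2)
    rw [setLIntegral_const, Measure.addHaar_ball_center] at h1
    calc ∫⁻ x in ball z 1, ‖a τ x‖ₑ ^ 2 ≤ ENNReal.ofReal ((2 * A) ^ 2) * volume (ball (0 : EuclideanSpace ℝ (Fin 3)) 1) := h1
      _ = (αA : ℝ≥0∞) := by rw [hαA, ENNReal.coe_mul, hv1c]; rfl
  have hslice := ae_restrict_of_ae_restrict_of_subset (Ioo_subset_Ioo_right hTuT') hu.ae_aestronglyMeasurable_slice'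
  have hαv' : ∀ᵐ τ ∂(volume.restrict (Ioo 0 Tu)), ∀ z : EuclideanSpace ℝ (Fin 3),
      ∫⁻ x in ball z 1, ‖u τ x - a τ x‖ₑ ^ 2 ≤ αv := by
    filter_upwards [hEu', ae_restrict_mem measurableSet_Ioo, hslice] with τ hτ hτI hτm z
    have hτS : τ ∈ Ioo 0 S₂ := ⟨hτI.1, hτI.2.trans_le hTuS₂⟩
    have hmeas : AEMeasurable (fun x => 2 * ‖u τ x‖ₑ ^ 2) (volume.restrict (ball z 1)) :=
      ((hτm.aemeasurable.enorm.pow_const 2).const_mul 2).restrict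
    calc ∫⁻ x in ball z 1, ‖u τ x - a τ x‖ₑ ^ 2 ≤ ∫⁻ x in ball z 1, (2 * ‖u τ x‖ₑ ^ 2 + 2 * ‖a τ x‖ₑ ^ 2) :=
          lintegral_mono fun x => enorm_sub_sq_le_two _ _
      _ = (2 * ∫⁻ x in ball z 1, ‖u τ x‖ₑ ^ 2) + 2 * ∫⁻ x in ball z 1, ‖a τ x‖ₑ ^ 2 := by
          rw [lintegral_add_left' hmeas, lintegral_const_mul' _ _ ENNReal.ofNat_ne_top,
            lintegral_const_mul' _ _ ENNReal.ofNat_ne_top]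
      _ ≤ 2 * (αu : ℝ≥0∞) + 2 * (αA : ℝ≥0∞) := by
          gcongr
          · exact hτ z
          · exact haE τ hτS z
      _ = (αv : ℝ≥0∞) := by rw [hαv]; push_cast; ring
  /- ## Part E: the decay at every centre `y ∈ B_{7/12}(x₀)` -/
  have hαv'' : ∀ᵐ τ ∂(volume.restrict (Ioo 0 (min Tu S₀))), ∀ z : EuclideanSpace ℝ (Fin 3),
      ∫⁻ x in ball z 1, ‖u τ x - a τ x‖ₑ ^ 2 ≤ αv := by
    rw [min_eq_left hTuS₀]; exact hαv'
  have hdecay : ∀ y ∈ ball x₀ (7 / 12), ∀ t ∈ Ioc 0 Tu,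
      (∀ᵐ s ∂(volume.restrict (Ioo 0 t)),
          ∫⁻ x in ball y (3 / 1024), ‖u s x - a s x‖ₑ ^ 2 ≤ Λ * ENNReal.ofReal (t ^ (3 / 2 : ℝ))) ∧
        ∫⁻ z in Ioo 0 t ×ˢ ball y (3 / 1024),
            ENNReal.ofReal (frobeniusNormSq (G z.1 z.2 - fderiv ℝ (a z.1) z.2)) ≤
          Λ * ENNReal.ofReal (t ^ (3 / 2 : ℝ)) := by
    intro y hy t ht
    have hyr : ball y (3 / 4) ⊆ ball x₀ (4 / 3) := by
      intro x hx
      rw [mem_ball] at hx hy ⊢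
      linarith [dist_triangle x y x₀]
    have htT : t ≤ min Tu S₀ := by rw [min_eq_left hTuS₀]; exact ht.2
    have hE1 : ∀ᵐ s ∂(volume.restrict (Ioo 0 t)), ∫⁻ x in ball y (3 / 4), ‖u s x - a s x‖ₑ ^ 2 ≤ E₀ := by
      have h := ae_restrict_of_ae_restrict_of_subset (Ioo_subset_Ioo_right ht.2) hαv'
      filter_upwards [h] with s hs
      calc ∫⁻ x in ball y (3 / 4), ‖u s x - a s x‖ₑ ^ 2 ≤ ∫⁻ x in ball y 1, ‖u s x - a s x‖ₑ ^ 2 :=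
            lintegral_mono_set (ball_subset_ball (by norm_num))
        _ ≤ αv := hs y
        _ ≤ (E₀ : ℝ≥0∞) := by rw [hE₀]; push_cast; exact le_self_add
    have hE2 : ∫⁻ z in Ioo 0 t ×ˢ ball y (3 / 4),
        ENNReal.ofReal (frobeniusNormSq (G z.1 z.2 - fderiv ℝ (a z.1) z.2)) ≤ E₀ := by
      have hsub : Ioo 0 t ×ˢ ball y (3 / 4) ⊆ Ioo 0 Tu ×ˢ ball y 1 :=
        Set.prod_mono (Ioo_subset_Ioo_right ht.2) (ball_subset_ball (by norm_num))
      have hGm : AEStronglyMeasurable (uncurry G) (volume.restrict (Ioo 0 Tu ×ˢ ball y 1)) :=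
        (hG.locallyIntegrableOn_grad.mono_set (fun z hz => mem_slab.2 hz.1)).aestronglyMeasurable
      have hGm' : AEMeasurable (fun z : ℝ × EuclideanSpace ℝ (Fin 3) => 2 * ENNReal.ofReal (frobeniusNormSq (G z.1 z.2)))
          (volume.restrict (Ioo 0 Tu ×ˢ ball y 1)) :=
        (continuous_frobeniusNormSq'.comp_aestronglyMeasurable hGm).aemeasurable.ennreal_ofReal.const_mul _
      calc ∫⁻ z in Ioo 0 t ×ˢ ball y (3 / 4), ENNReal.ofReal (frobeniusNormSq (G z.1 z.2 - fderiv ℝ (a z.1) z.2))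
          ≤ ∫⁻ z in Ioo 0 Tu ×ˢ ball y 1, ENNReal.ofReal (frobeniusNormSq (G z.1 z.2 - fderiv ℝ (a z.1) z.2)) :=
            lintegral_mono_set hsub
        _ ≤ ∫⁻ z in Ioo 0 Tu ×ˢ ball y 1, (2 * ENNReal.ofReal (frobeniusNormSq (G z.1 z.2)) +
              2 * ENNReal.ofReal (frobeniusNormSq (fderiv ℝ (a z.1) z.2))) :=
            lintegral_mono fun z => ofReal_frobeniusNormSq_sub_le_two _ _
        _ = (2 * ∫⁻ z in Ioo 0 Tu ×ˢ ball y 1, ENNReal.ofReal (frobeniusNormSq (G z.1 z.2))) +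
              2 * ∫⁻ z in Ioo 0 Tu ×ˢ ball y 1, ENNReal.ofReal (frobeniusNormSq (fderiv ℝ (a z.1) z.2)) := by
            rw [lintegral_add_left' hGm', lintegral_const_mul' _ _ ENNReal.ofNat_ne_top,
              lintegral_const_mul' _ _ ENNReal.ofNat_ne_top]
        _ ≤ 2 * ((CD * α : ℝ≥0) : ℝ≥0∞) + 2 * ((CD * αa : ℝ≥0) : ℝ≥0∞) := by
            gcongr
            · exact hGu y
            · exact hGa y
        _ ≤ (E₀ : ℝ≥0∞) := by rw [hE₀]; push_cast; exact le_add_self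
    exact hΛ hTupos hm₀ huT hG hGb hS₀pos hS₀S₂ hA hC₁ haL hcl habd hagrad (by norm_num : (0 : ℝ) < 4 / 3) ha₀eq hyr
      hαv'' ht.1 htT (ht.2.trans hTu1) hE1 hE2
  /- ## Part F: boundedness near the initial time -/
  have hbd := hF huT hG hcl habd hTupos le_rfl hTuS₂ hEu' hdecay
  have hbd' : ∀ᵐ z ∂(volume.restrict (Ioo 0 (min T₂ Tu) ×ˢ ball x₀ (7 / 12))), ‖u z.1 z.2‖ ≤ max Kb 0 :=
    hbd.mono fun z hz => hz.trans (le_max_left _ _)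
  /- ## Part G: the Hölder continuous representative -/
  have hTT : min T T' = min T₂ Tu := by rw [hTdef, hTu, min_assoc]
  have hT₀pos : 0 < min T₂ Tu := lt_min hT₂ hTupos
  have hreps : ∀ Tb : ℝ, 0 < Tb → Tb < min T₂ Tu →
      ∃ U : ℝ → (EuclideanSpace ℝ (Fin 3)) → (EuclideanSpace ℝ (Fin 3)),
        uncurry U =ᵐ[volume.restrict (Ioo 0 Tb ×ˢ ball x₀ (1 / 4))] uncurry u ∧
        (∀ x ∈ closedBall x₀ (1 / 4), U 0 x = u₀ x) ∧
        (∀ z ∈ Icc 0 Tb ×ˢ closedBall x₀ (1 / 4), ‖uncurry U z‖ ≤ CU) ∧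
        IsParabolicHolderOn (Icc 0 Tb ×ˢ closedBall x₀ (1 / 4)) (uncurry U) CU γ := fun Tb hTb hTbT =>
    hG6 hm₀ huT hTb hTbT (min_le_right _ _) (hTbT.le.trans ((min_le_right _ _).trans hTu1)) hM hH hbd' hEu'
  obtain ⟨U, hU1, hU2, hU3, hU4⟩ := exists_holder_rep_of_forall_lt hT₀pos hγ0' hreps
  refine ⟨U, ?_, hU2, ?_, ?_⟩
  · rw [hTT]; exact hU1
  · rw [hTT]; exact hU3
  · rw [hTT]; exact hU4

end Literature.Analysis.FluidPDE

end
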